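import Summits.KontsevichZagierPeriods.KontsevichZagierPeriods.Theorems.SoloInformedScissorsCompactify
import HarnessLib
import HarnessLib.Audit

/-!
# SoloInformed — compact representatives in the scissors calculus `𝒮`

Solo programme `solo-KontsevichZagierPeriods-informed`, session s261 (file 4).

The compactification lemma (`soloInformed_exists_isBounded_sub_mem_scissorsRel`) produces a BOUNDED
representative of every class of `𝒦ₙ = ℤ[volume representations of dimension n]/𝒮`.  Passing to the
closure is one more scissors move (the frontier of a semialgebraic set is Lebesgue-null,
`volume_frontier_eq_zero_of_isSemialgebraic`; the closure of a `ℚ`-semialgebraic set is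
`ℚ`-semialgebraic, `isSemialgebraic_closure`), so every class of `𝒦ₙ` is the class of a COMPACT
`ℚ`-semialgebraic set (`soloInformed_exists_isCompact_sub_mem_scissorsRel`) — exactly the generators of
the cut-and-paste ring `K₀(CSA)` of [Cueto–Viu-Sos 2022, (2.2)] (with `ℚ` for `ℝ_alg`).  In particular
the comparison map `K₀(CSA^ℚ)ₙ → 𝒦ₙ` of `nl-elimination.md` NF.4 is SURJECTIVE on generators, and the
period conjecture is equivalent to the stable generalized Hilbert third problem for COMPACT
`ℚ`-semialgebraic sets (`soloInformed_summit_iff_stableH3Cpt`): two compact `ℚ`-semialgebraic sets of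
equal volume become congruent by cut-and-paste up to null sets and volume-preserving `ℚ`-semialgebraic
`C¹` maps after multiplying both by a cube `[0,1]^k`.

References: [Kontsevich–Zagier 2001, §1.2]; [Viu-Sos 2021, §4.2] (closure step of the semi-canonical
reduction); [Cueto–Viu-Sos 2022, (2.2)–(2.6), Conj. 1.1, Thm. 2.1]; this work (`nl-elimination.md`
COROLLARY NF.2, REMARK NF.4(3)).
-/

noncomputable section

open scoped BigOperators Topology ENNReal

namespace Summit.KontsevichZagierPeriods.KontsevichZagierPeriods.Theorems

open Set MeasureTheory Filter
open Literature.ModelTheory.ExponentialFields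
open Literature.NumberTheory.Transcendental Literature.NumberTheory.Transcendental.KZ

variable {n : ℕ}

/-- **Passing to the closure is a scissors move.** A bounded volume representation `(D, 1)` is
scissors congruent in `𝒮` to `(closure D, 1)`, whose domain is compact (and has non-empty interior as
soon as `vol D > 0`): `closure D ∖ D ⊆ frontier D` is null. [Viu-Sos 2021, §4.2; this work] -/
theorem soloInformed_exists_closure_sub_mem_scissorsRel (r : IntegralRep n) (hr : SoloInformedIsVolRep r)
    (hb : Bornology.IsBounded r.domain) :
    ∃ K : IntegralRep n, K.domain = closure r.domain ∧ IsCompact K.domain ∧ SoloInformedIsVolRep K ∧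
      (0 < volume r.domain → (interior K.domain).Nonempty) ∧ of r - of K ∈ soloInformedScissorsRel := by
  have hcl : IsSemialgebraic ℚ (closure r.domain) := isSemialgebraic_closure r.isSemialgebraic_domain
  have hcpt : IsCompact (closure r.domain) := hb.isCompact_closure
  obtain ⟨K, hKd, hKi⟩ := exists_oneRep hcl hcpt.measure_lt_top.ne
  have hKv : SoloInformedIsVolRep K := fun x _ => by rw [hKi]
  refine ⟨K, hKd, hKd ▸ hcpt, hKv, fun hpos => ?_, ?_⟩
  · by_contra hne
    rw [not_nonempty_iff_eq_empty] at hne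
    have h0 : volume K.domain = 0 := volume_eq_zero_of_interior_eq_empty K.isSemialgebraic_domain hne
    rw [hKd] at h0
    exact hpos.ne' (measure_mono_null subset_closure h0)
  · have hsub : r.domain ⊆ K.domain := hKd ▸ subset_closure
    have hnull : volume (K.domain \ r.domain) = 0 := by
      rw [hKd]
      refine measure_mono_null (fun x hx => ?_)
        (volume_frontier_eq_zero_of_isSemialgebraic r.isSemialgebraic_domain)
      exact ⟨hx.1, fun hx' => hx.2 (interior_subset hx')⟩
    have h := soloInformed_of_sub_of_mem_scissorsRel_of_subset hKv hr hsub hnull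
    rw [← neg_sub] at h
    simpa using neg_mem h

/-- **Every class of `𝒦ₙ` is the class of a COMPACT `ℚ`-semialgebraic set** (with the same volume):
compactify (`soloInformed_exists_isBounded_sub_mem_scissorsRel`) and close up
(`soloInformed_exists_closure_sub_mem_scissorsRel`). These are the generators of the cut-and-paste
ring of [Cueto–Viu-Sos 2022, (2.2)]. [this work, nl-elimination.md NF.4(3)] -/
theorem soloInformed_exists_isCompact_sub_mem_scissorsRel (A : IntegralRep n)
    (hA : SoloInformedIsVolRep A) :
    ∃ K : IntegralRep n, IsCompact K.domain ∧ SoloInformedIsVolRep K ∧ K.value = A.value ∧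
      of A - of K ∈ soloInformedScissorsRel := by
  obtain ⟨B, hBb, hBv, hAB⟩ := soloInformed_exists_isBounded_sub_mem_scissorsRel A hA
  obtain ⟨K, -, hKc, hKv, -, hBK⟩ := soloInformed_exists_closure_sub_mem_scissorsRel B hBv hBb
  have hAK : of A - of K ∈ soloInformedScissorsRel := by
    have := add_mem hAB hBK
    rwa [sub_add_sub_cancel] at this
  exact ⟨K, hKc, hKv, (Equivalent.value_eq_holds (soloInformed_scissorsRel_le_relations hAK)).symm, hAK⟩

/-! ### Hilbert's third problem of the calculus: compact sets suffice -/

/-- `H3^cpt_n`: the generalized Hilbert third problem of the calculus in dimension `n` for COMPACT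
`ℚ`-semialgebraic sets. [this work] -/
def SoloInformedH3CptAt (n : ℕ) : Prop :=
  ∀ (r r' : IntegralRep n), SoloInformedIsVolRep r → SoloInformedIsVolRep r' →
    IsCompact r.domain → IsCompact r'.domain →
    r.value = r'.value → of r - of r' ∈ soloInformedScissorsRel

/-- **`H3_n ⟺ H3^cpt_n`.** [this work, nl-elimination.md NF.4(3)] -/
theorem soloInformed_h3At_iff_h3CptAt (n : ℕ) : SoloInformedH3At n ↔ SoloInformedH3CptAt n := by
  constructor
  · intro h r r' hr hr' _ _ hv
    exact h r r' hr hr' hv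
  · intro h r r' hr hr' hv
    obtain ⟨b, hbc, hbv, hbval, hrb⟩ := soloInformed_exists_isCompact_sub_mem_scissorsRel r hr
    obtain ⟨b', hb'c, hb'v, hb'val, hr'b'⟩ := soloInformed_exists_isCompact_sub_mem_scissorsRel r' hr'
    have hbb' : of b - of b' ∈ soloInformedScissorsRel :=
      h b b' hbv hb'v hbc hb'c (by rw [hbval, hb'val, hv])
    have : of r - of r' = (of r - of b) + (of b - of b') - (of r' - of b') := by abel
    rw [this]
    exact sub_mem (add_mem hrb hbb') hr'b'

/-- `STABLE-H3^cpt`: the stable generalized Hilbert third problem of the calculus for COMPACT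
`ℚ`-semialgebraic sets — two compact volume representations (any dimension) with the same volume
become scissors congruent after finitely many flattenings `× [0,1]`. [this work] -/
def SoloInformedStableH3Cpt : Prop :=
  ∀ (n : ℕ) (r r' : IntegralRep n), SoloInformedIsVolRep r → SoloInformedIsVolRep r' →
    IsCompact r.domain → IsCompact r'.domain → r.value = r'.value →
      ∃ k, of (soloInformedFlatIter r k) - of (soloInformedFlatIter r' k) ∈ soloInformedScissorsRel

/-- **`STABLE-H3 ⟺ STABLE-H3^cpt`.** [this work, nl-elimination.md NF.4(3)] -/
theorem soloInformed_stableH3_iff_stableH3Cpt : SoloInformedStableH3 ↔ SoloInformedStableH3Cpt := by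
  constructor
  · intro h n r r' hr hr' _ _ hv
    exact h n r r' hr hr' hv
  · intro h n r r' hr hr' hv
    obtain ⟨b, hbc, hbv, hbval, hrb⟩ := soloInformed_exists_isCompact_sub_mem_scissorsRel r hr
    obtain ⟨b', hb'c, hb'v, hb'val, hr'b'⟩ := soloInformed_exists_isCompact_sub_mem_scissorsRel r' hr'
    obtain ⟨k, hk⟩ := h n b b' hbv hb'v hbc hb'c (by rw [hbval, hb'val, hv])
    refine ⟨k, ?_⟩
    have hrbk : of (soloInformedFlatIter r k) - of (soloInformedFlatIter b k) ∈
        soloInformedScissorsRel :=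
      soloInformed_flatIter_sub_mem_scissorsRel_of_le (Nat.zero_le k) hrb
    have hr'b'k : of (soloInformedFlatIter r' k) - of (soloInformedFlatIter b' k) ∈
        soloInformedScissorsRel :=
      soloInformed_flatIter_sub_mem_scissorsRel_of_le (Nat.zero_le k) hr'b'
    have : of (soloInformedFlatIter r k) - of (soloInformedFlatIter r' k) =
        (of (soloInformedFlatIter r k) - of (soloInformedFlatIter b k)) +
        (of (soloInformedFlatIter b k) - of (soloInformedFlatIter b' k)) -
        (of (soloInformedFlatIter r' k) - of (soloInformedFlatIter b' k)) := by abel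
    rw [this]
    exact sub_mem (add_mem hrbk hk) hr'b'k

/-- **The period conjecture is the stable generalized Hilbert third problem for COMPACT
`ℚ`-semialgebraic sets**: `KontsevichZagierPeriods ⟺ STABLE-H3^cpt`.  This is the `♭`-variant of
[Cueto–Viu-Sos 2022, Conj. 1.1 ⟹ KZ (Thm. 2.1)] with BOTH directions, on compact generators.
[this work, COROLLARY NF.2 + nl-elimination.md NF.4(3)] -/
theorem soloInformed_summit_iff_stableH3Cpt : KontsevichZagierPeriods ↔ SoloInformedStableH3Cpt :=
  soloInformed_summit_iff_stableH3.trans soloInformed_stableH3_iff_stableH3Cpt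

end Summit.KontsevichZagierPeriods.KontsevichZagierPeriods.Theorems

end
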